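import Summits.BirchSwinnertonDyer.BirchSwinnertonDyer.Theorems.CyclotomicUntwistPSTamagawaThreeNormalForm
import Summits.BirchSwinnertonDyer.Rank1Residual.Additive.LocalThreeTorsionIffTamagawaThreeOfIVHolds
import Summits.BirchSwinnertonDyer.Rank1Residual.Additive.GordKodairaType
import Literature.RingTheory.DiscreteValuationRing.AdicCompletionHensel
import Literature.NumberTheory.EllipticCurves.ModularCurveManinSemistableCoprimeFormProofs
import Literature.NumberTheory.DiophantineGeometry.ConductorExponentLeFiveProofs
import HarnessLib

/-!
# LAW L-c3, transport layer: the complete local ring `𝒪_{ℚ,(3)}` (uniformiser `3`, residue field `𝔽₃`),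
# the exact valuations `v₃ c₆` on the Tate normal forms `IV` / `IV*`, and the `3`-adic unit between the
# Tate model at `(3)` and the global minimal model (route `CyclotomicUntwist`, cruxes K1/K2)

Cell `pub/bsd-wall` (D-0145 line `route-BirchSwinnertonDyer-CyclotomicUntwist`), seat `bsd-line-cycu-p2`
(prover seat 2/3, gen 3), helper toward the cruxes K1 `PSRankOneLowerHalfAtThree`
(stmt-BirchSwinnertonDyer-21580; binder `¬ 3 ∣ W.tamagawaProduct` of the registered stub
`stub_rung_lowerHalfOnGNine_towerUnit`) and K2 `PSRankOneUpperHalfAtThree` (stmt-21581; "why it might fail: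
`c₃ = 3` occurs on IV/IV* rows"). THEOREMS ONLY (no definition, no named fact, no `sorry`); BSD is not
proved by this file and no crux is. Middle file of the kernel proof of the census law **L-c3**
(`Cruxes/PSRankOneUpperHalfAtThree/K2-TAMAGAWA-AT-3-v1.md`, cycu-p4 g2) between the DVR kernel
`CyclotomicUntwistPSTamagawaThreeNormalForm.lean` (p599771) and the `ℚ`-level law
`CyclotomicUntwistPSTamagawaThreeLaw.lean`.

## What is proved

* §1 `𝒪 = 𝒪_{ℚ,(3)} = (placeOf 3).adicCompletionIntegers ℚ`: `2` is a unit and `3` a uniformiser (tree,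
  `Rat.isUnit_two_and_irreducible_three_of_natGenerator_eq_three`); the residue field is `𝔽₃`-like,
  `x ≠ 0 → x² = 1` (`residueField_sq_eq_one_placeOf_three`, via Mathlib's `padicIntEquiv : 𝒪_v ≃ ℤ_[p]`,
  `PadicInt.residueField` and `ZMod.pow_card_sub_one_eq_one`, stated over a general integer ring of `ℚ`
  to avoid the `Algebra ℤ 𝒪_v` diamond); `3ᵏ ∣ (n : 𝒪) ⟺ 3ᵏ ∣ n` for `n ∈ ℤ`
  (`three_pow_dvd_intCast_iff`, `PadicInt.pow_p_dvd_int_iff`); `residue (m : 𝒪) = 1 ⟺ m % 3 = 1`.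
* §2 (any DVR with uniformiser `3`, perfect residue field) the EXACT valuations on Tate's normal forms:
  type `IV` with `3⁶ ∣ Δ(I)` gives `c₆(I) = 3⁵·unit` (`exists_c₆_eq_pow_five_mul_of_kodairaSymbolOfMinimal_eq_IV`,
  the Kraus signature `(3, 5, 6)`), type `IV*` with `3¹⁰ ∥ Δ(I)` gives `c₆(I) = 3⁶·unit`, `Δ(I) = 3¹⁰·unit`
  (`exists_c₆_Δ_eq_pow_mul_of_kodairaSymbolOfMinimal_eq_IVstar`, signature `(4, 6, 10)`).
* §3 **`exists_isUnit_c₆_Δ_eq_mul_localMinimalIntegralModel`**: for `W/ℚ` globally minimal,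
  `(c₆(W_ℤ) : 𝒪) = a⁶ · c₆(I)` and `(Δ_min : 𝒪) = a¹² · Δ(I)` for the Tate model
  `I = W.localMinimalIntegralModel (placeOf 3)` and a unit `a ∈ 𝒪` (Silverman *AEC* VII.1.3(b): two minimal
  models differ by `u ∈ 𝒪ˣ`; tree `exists_algebraMap_eq_u_of_isMinimal`, `IsGloballyMinimal.isMinimalAt_int`).

References: J. H. Silverman, *Advanced Topics in the Arithmetic of Elliptic Curves*, GTM 151 (1994), IV.9.4
Steps 5, 8 [SilvermanATAEC1994]; *The Arithmetic of Elliptic Curves*, 2nd ed. (2009), VII.1 Prop. 1.3(b),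
VIII.8 [SilvermanAEC2009]; A. Kraus, Manuscripta Math. 69 (1990), Théorème (p = 3) [Kraus1990];
J.-P. Serre, *Local Fields*, II §4 (`ℤ₃/3 = 𝔽₃`) [folklore].
-/


noncomputable section

open scoped Classical

open IsLocalRing IsDedekindDomain WeierstrassCurve Rat.HeightOneSpectrum
  Literature.NumberTheory.EllipticCurves Literature.NumberTheory.EllipticCurves.Rank1Residual
  Literature.NumberTheory.DiophantineGeometry Summit.BirchSwinnertonDyer.Rank1Residual.Additive

-- single-conjunct summit: `Summit.BirchSwinnertonDyer.BirchSwinnertonDyer.…` repeats the name by design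
set_option linter.dupNamespace false
set_option autoImplicit false

namespace Summit.BirchSwinnertonDyer.BirchSwinnertonDyer.Theorems.PSTamagawaThree

/-! ### §1 The complete local ring `𝒪_{ℚ,(3)}`: uniformiser `3`, unit `2`, residue field `𝔽₃` -/

section LocalRing

/-- The rational prime below `placeOf 3` is `3`. [folklore] -/
theorem natGenerator_placeOf_three' : natGenerator (placeOf 3) = 3 :=
  Literature.NumberTheory.EllipticCurves.Rat.natGenerator_primesEquiv_symm ⟨3, Nat.prime_three⟩

/-- In `𝒪_{ℚ,(3)}`: `2` is a unit and `3` is a uniformiser. [folklore] -/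
theorem isUnit_two_and_irreducible_three_placeOf_three :
    IsUnit (2 : (placeOf 3).adicCompletionIntegers ℚ) ∧
      Irreducible (3 : (placeOf 3).adicCompletionIntegers ℚ) :=
  Literature.NumberTheory.DiophantineGeometry.Rat.isUnit_two_and_irreducible_three_of_natGenerator_eq_three
    (placeOf 3) natGenerator_placeOf_three'

/-- The residue field of `𝒪_{ℚ,(p)}` (`v` over `p`) is `𝔽_p`-like: every non-zero element has
`x^{p-1} = 1` (transport along Mathlib's `padicIntEquiv : 𝒪_v ≃ ℤ_[p]` and `PadicInt.residueField :
ℤ_[p]/(p) ≃ ZMod p`, then `ZMod.pow_card_sub_one_eq_one`); stated for a general integer ring `R` of `ℚ`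
to avoid the `Algebra ℤ 𝒪_v` diamond, as the tree's `Rat.finite_residueField_adicCompletionIntegers`. [folklore] -/
theorem residueField_pow_sub_one_eq_one {R : Type*} [CommRing R] [IsDedekindDomain R]
    [Algebra R ℚ] [IsFractionRing R ℚ] [IsIntegralClosure R ℤ ℚ] (v : HeightOneSpectrum R) (p : ℕ)
    [Fact p.Prime] (hv : (primesEquiv (R := R) v : ℕ) = p)
    (x : ResidueField (v.adicCompletionIntegers ℚ)) (hx : x ≠ 0) : x ^ (p - 1) = 1 := by
  subst hv
  set e : ResidueField (v.adicCompletionIntegers ℚ) ≃+* ZMod (primesEquiv (R := R) v : ℕ) :=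
    (ResidueField.mapEquiv (adicCompletionIntegers.padicIntEquiv v).toRingEquiv).trans
      (PadicInt.residueField (p := (primesEquiv (R := R) v : ℕ))) with he
  have hex : e x ≠ 0 := (map_ne_zero e).mpr hx
  have h := ZMod.pow_card_sub_one_eq_one hex
  apply e.injective
  rw [map_pow, map_one, h]

/-- The residue field of `𝒪_{ℚ,(3)}` is `𝔽₃`-like: `x ≠ 0 → x² = 1`. [folklore] -/
theorem residueField_sq_eq_one_placeOf_three
    (x : ResidueField ((placeOf 3).adicCompletionIntegers ℚ)) (hx : x ≠ 0) : x ^ 2 = 1 := by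
  have h := residueField_pow_sub_one_eq_one (placeOf 3) 3 (primesEquiv_placeOf_val 3) x hx
  simpa using h

/-- Divisibility of an INTEGER by a prime power is the same in `ℤ` and in `𝒪_{ℚ,(p)}`
(`PadicInt.pow_p_dvd_int_iff` along `padicIntEquiv`). [folklore] -/
theorem pow_dvd_intCast_iff {R : Type*} [CommRing R] [IsDedekindDomain R] [Algebra R ℚ]
    [IsFractionRing R ℚ] [IsIntegralClosure R ℤ ℚ] (v : HeightOneSpectrum R) (p : ℕ) [Fact p.Prime]
    (hv : (primesEquiv (R := R) v : ℕ) = p) (k : ℕ) (n : ℤ) :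
    ((p : ℕ) : v.adicCompletionIntegers ℚ) ^ k ∣ (n : v.adicCompletionIntegers ℚ) ↔
      (p : ℤ) ^ k ∣ n := by
  subst hv
  set e := (adicCompletionIntegers.padicIntEquiv v).toRingEquiv with he
  rw [← map_dvd_iff e, map_pow, map_natCast, map_intCast, PadicInt.pow_p_dvd_int_iff]

/-- At the place `(3)`: `3ᵏ ∣ (n : 𝒪) ⟺ 3ᵏ ∣ n`. [folklore] -/
theorem three_pow_dvd_intCast_iff (k : ℕ) (n : ℤ) :
    (3 : (placeOf 3).adicCompletionIntegers ℚ) ^ k ∣ (n : (placeOf 3).adicCompletionIntegers ℚ) ↔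
      (3 : ℤ) ^ k ∣ n := by
  have h := pow_dvd_intCast_iff (placeOf 3) 3 (primesEquiv_placeOf_val 3) k n
  simpa using h

/-- The residue of an integer `m` in `𝒪_{ℚ,(3)}/𝔪 = 𝔽₃` is `1` iff `m % 3 = 1`. [folklore] -/
theorem residue_intCast_eq_one_iff (m : ℤ) :
    residue ((placeOf 3).adicCompletionIntegers ℚ) (m : (placeOf 3).adicCompletionIntegers ℚ) = 1 ↔
      m % 3 = 1 := by
  have h3 := isUnit_two_and_irreducible_three_placeOf_three.2
  rw [← map_one (residue ((placeOf 3).adicCompletionIntegers ℚ)), residue_eq_residue_iff_of_three h3,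
    show (1 : (placeOf 3).adicCompletionIntegers ℚ) = ((1 : ℤ) : (placeOf 3).adicCompletionIntegers ℚ)
      by norm_num, ← Int.cast_sub, ← pow_one (3 : (placeOf 3).adicCompletionIntegers ℚ),
    three_pow_dvd_intCast_iff, pow_one]
  omega

end LocalRing

/-! ### §2 Local valuation consequences of the normal forms (DVR level; `v₃ c₆` exact) -/

section DVR

open Literature.NumberTheory.EllipticCurves.LocalIndex Literature.NumberTheory.DiophantineGeometry.TateAlgorithm

variable {R : Type*} [CommRing R] [IsDomain R] [IsDiscreteValuationRing R]

/-- `3ᵏ ∣ x ⟺ k ≤ ord(x)` when `3` is a uniformiser. [folklore] -/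
theorem three_pow_dvd_iff_le_addVal (h3 : Irreducible (3 : R)) (x : R) (k : ℕ) :
    (3 : R) ^ k ∣ x ↔ (k : ℕ∞) ≤ IsDiscreteValuationRing.addVal R x := by
  rw [← IsDiscreteValuationRing.addVal_le_iff_dvd, IsDiscreteValuationRing.addVal_pow,
    IsDiscreteValuationRing.addVal_uniformizer h3]
  simp

/-- **Type `IV` with `3⁶ ∣ Δ`: `c₆ = 3⁵ · unit`** (the Kraus signature `v₃ c₆ = 5` of the row
`v₃ Δ = 6`; from the normal form, `c₆/3⁵ ≡ γ² + 4ε ≢ 0`). [cite: Kraus1990, Théorème (p = 3)] [cite: SilvermanATAEC1994, IV.9.4 Step 5] -/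
theorem exists_c₆_eq_pow_five_mul_of_kodairaSymbolOfMinimal_eq_IV [PerfectField (ResidueField R)]
    (h3 : Irreducible (3 : R)) (I : WeierstrassCurve R) (hI : I.kodairaSymbolOfMinimal = .IV)
    (h6 : (3 : R) ^ 6 ∣ I.Δ) : ∃ κ : R, I.c₆ = 3 ^ 5 * κ ∧ ¬ (3 : R) ∣ κ := by
  have h3p : Prime (3 : R) := h3.prime
  obtain ⟨D, h1, h2, h3', h4, h6', hb₆⟩ := exists_smul_of_kodairaSymbolOfMinimal_eq_IV I hI
  obtain ⟨α, hα⟩ := (mem_maximalIdeal_iff_of_three h3 _).mp h1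
  obtain ⟨β, hβ⟩ := (mem_maximalIdeal_iff_of_three h3 _).mp h2
  obtain ⟨γ, hγ⟩ := (mem_maximalIdeal_iff_of_three h3 _).mp h3'
  obtain ⟨δ, hδ⟩ := (mem_pow_maximalIdeal_iff_of_three h3 _ 2).mp h4
  obtain ⟨ε, hε⟩ := (mem_pow_maximalIdeal_iff_of_three h3 _ 2).mp h6'
  have hE : ¬ (3 : R) ∣ γ ^ 2 + 4 * ε := by
    intro hE
    apply hb₆
    rw [mem_pow_maximalIdeal_iff_of_three h3, WeierstrassCurve.b₆, hγ, hε]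
    obtain ⟨w, hw⟩ := hE
    exact ⟨w, by linear_combination (9 : R) * hw⟩
  have h6J : (3 : R) ^ 6 ∣ (D • I).Δ := by
    rw [WeierstrassCurve.variableChange_Δ]
    exact Dvd.dvd.mul_left h6 _
  obtain ⟨κJ, hκJ, hκJE⟩ := exists_c₆_eq_of_normalForm_IV h3p (D • I) hα hβ hγ hδ hε h6J hE
  refine ⟨(D.u : R) ^ 6 * κJ, by rw [c₆_eq_units_pow_mul_c₆_smul I D, hκJ]; ring, fun h ↦ ?_⟩
  rcases h3p.dvd_or_dvd h with h' | h'
  · exact h3p.not_unit (isUnit_of_dvd_unit (h3p.dvd_of_dvd_pow h') (Units.isUnit _))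
  · exact hE (by simpa using (dvd_sub h' hκJE))

/-- **Type `IV*` with `3¹⁰ ∥ Δ`: `c₆ = 3⁶ · unit` and `Δ = 3¹⁰ · unit`** (the Kraus signature
`v₃ c₆ = 6` of the row `v₃ Δ = 10`; `c₆/3⁶ ≡ −(b₂/9)³`, `Δ/3¹⁰ ≡ −(b₂/9)³ (b₆/81)`).
[cite: Kraus1990, Théorème (p = 3)] [cite: SilvermanATAEC1994, IV.9.4 Step 8] -/
theorem exists_c₆_Δ_eq_pow_mul_of_kodairaSymbolOfMinimal_eq_IVstar [PerfectField (ResidueField R)]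
    (h3 : Irreducible (3 : R)) (I : WeierstrassCurve R) (hI : I.kodairaSymbolOfMinimal = .IVstar)
    (h10 : (3 : R) ^ 10 ∣ I.Δ) (h11 : ¬ (3 : R) ^ 11 ∣ I.Δ) :
    ∃ κ μ : R, I.c₆ = 3 ^ 6 * κ ∧ I.Δ = 3 ^ 10 * μ ∧ ¬ (3 : R) ∣ κ ∧ ¬ (3 : R) ∣ μ := by
  have h3p : Prime (3 : R) := h3.prime
  obtain ⟨D, h1, h2, h3', h4, h6', -⟩ := exists_smul_of_kodairaSymbolOfMinimal_eq_IVstar I hI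
  obtain ⟨α, hα⟩ := (mem_maximalIdeal_iff_of_three h3 _).mp h1
  obtain ⟨β, hβ⟩ := (mem_pow_maximalIdeal_iff_of_three h3 _ 2).mp h2
  obtain ⟨γ, hγ⟩ := (mem_pow_maximalIdeal_iff_of_three h3 _ 2).mp h3'
  obtain ⟨δ, hδ⟩ := (mem_pow_maximalIdeal_iff_of_three h3 _ 3).mp h4
  obtain ⟨ε, hε⟩ := (mem_pow_maximalIdeal_iff_of_three h3 _ 4).mp h6'
  have h10J : (3 : R) ^ 10 ∣ (D • I).Δ := by
    rw [WeierstrassCurve.variableChange_Δ]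
    exact Dvd.dvd.mul_left h10 _
  obtain ⟨κJ, μJ, hκJ, hμJ, hκB, hμB⟩ :=
    exists_c₆_Δ_eq_of_normalForm_IVstar h3p (D • I) hα hβ hγ hδ hε h10J
  have hIc₆ : I.c₆ = 3 ^ 6 * ((D.u : R) ^ 6 * κJ) := by
    rw [c₆_eq_units_pow_mul_c₆_smul I D, hκJ]; ring
  have hIΔ : I.Δ = 3 ^ 10 * ((D.u : R) ^ 12 * μJ) := by
    rw [Δ_eq_units_pow_mul_Δ_smul I D, hμJ]; ring
  -- `3 ∤ μJ` from `3¹¹ ∤ Δ`, hence `3 ∤ α² + 4β`, hence `3 ∤ κJ`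
  have hμ3 : ¬ (3 : R) ∣ μJ := by
    rintro ⟨w, hw⟩
    apply h11
    exact ⟨(D.u : R) ^ 12 * w, by rw [hIΔ, hw]; ring⟩
  have hB3 : ¬ (3 : R) ∣ α ^ 2 + 4 * β := fun hB ↦
    hμ3 ((dvd_add_left (Dvd.dvd.mul_right (dvd_pow hB three_ne_zero) (γ ^ 2 + 4 * ε))).mp hμB)
  have hκ3 : ¬ (3 : R) ∣ κJ := fun hκ ↦
    hB3 (h3p.dvd_of_dvd_pow ((dvd_add_right hκ).mp hκB))
  have hu : ∀ {x : R} (n : ℕ), (3 : R) ∣ (D.u : R) ^ n * x → (3 : R) ∣ x := by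
    intro x n h
    rcases h3p.dvd_or_dvd h with h' | h'
    · exact absurd (isUnit_of_dvd_unit (h3p.dvd_of_dvd_pow h') (Units.isUnit _)) h3p.not_unit
    · exact h'
  exact ⟨_, _, hIc₆, hIΔ, fun h ↦ hκ3 (hu 6 h), fun h ↦ hμ3 (hu 12 h)⟩

end DVR

/-! ### §3 Transport from the local minimal model at `(3)` to the global minimal model over `ℤ` -/

section Transport

variable (W : WeierstrassCurve ℚ) [W.IsElliptic] [W.IsGloballyMinimal]

/-- **Two minimal models at `(3)` differ by a `3`-adic unit**: for `W/ℚ` globally minimal, the integer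
invariants `c₆(W_ℤ)` and `Δ_min` read in `𝒪 = 𝒪_{ℚ,(3)}` are `a⁶ · c₆(I)` and `a¹² · Δ(I)` for the Tate
model `I = W.localMinimalIntegralModel (placeOf 3)` and a UNIT `a ∈ 𝒪` (Silverman *AEC* VII.1.3(b),
tree `exists_algebraMap_eq_u_of_isMinimal`). [cite: SilvermanAEC2009, VII.1 Prop. 1.3(b)] -/
theorem exists_isUnit_c₆_Δ_eq_mul_localMinimalIntegralModel :
    ∃ a : (placeOf 3).adicCompletionIntegers ℚ, IsUnit a ∧
      (((integralModelInt W).c₆ : ℤ) : (placeOf 3).adicCompletionIntegers ℚ) =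
        a ^ 6 * (W.localMinimalIntegralModel (placeOf 3)).c₆ ∧
      ((W.minimalDiscriminantInt : ℤ) : (placeOf 3).adicCompletionIntegers ℚ) =
        a ^ 12 * (W.localMinimalIntegralModel (placeOf 3)).Δ := by
  set O := (placeOf 3).adicCompletionIntegers ℚ with hO
  set Kv := (placeOf 3).adicCompletion ℚ with hKv
  obtain ⟨C, hC⟩ : ∃ C : VariableChange Kv, W.localMinimalModel (placeOf 3) = C • W.baseChange Kv :=
    ⟨_, rfl⟩
  haveI hWmin : (W.baseChange Kv).IsMinimal O := IsGloballyMinimal.isMinimalAt_int W (placeOf 3)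
  haveI hCmin : (C • W.baseChange Kv).IsMinimal O := hC ▸ inferInstance
  have hΔ : (W.baseChange Kv).Δ ≠ 0 := by
    rw [baseChange, map_Δ]
    exact (map_ne_zero _).mpr (W.coe_Δ' ▸ W.Δ'.ne_zero)
  obtain ⟨⟨a, ha⟩, ⟨b, hb⟩⟩ := exists_algebraMap_eq_u_of_isMinimal O (W.baseChange Kv) C hΔ
  have hinj : Function.Injective (algebraMap O Kv) := IsFractionRing.injective O Kv
  have hab : a * b = 1 := hinj (by rw [map_mul, ha, hb, map_one, Units.mul_inv])
  have hba : algebraMap O Kv b * algebraMap O Kv a = 1 := by rw [hb, ha, Units.inv_mul]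
  refine ⟨a, isUnit_iff_exists_inv.mpr ⟨b, hab⟩, hinj ?_, hinj ?_⟩
  · have hc₆ : algebraMap O Kv (W.localMinimalIntegralModel (placeOf 3)).c₆ =
        (W.localMinimalModel (placeOf 3)).c₆ :=
      integralModel_c₆_eq O (W.localMinimalModel (placeOf 3))
    rw [map_intCast, map_mul, map_pow, hc₆, hC, variableChange_c₆, ← hb, baseChange, map_c₆,
      ← cast_integralModelInt_c₆, map_intCast]
    have h6 : ((algebraMap O Kv) b * (algebraMap O Kv) a) ^ 6 = 1 := by rw [hba, one_pow]
    linear_combination (-(((integralModelInt W).c₆ : ℤ) : Kv)) * h6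
  · have hΔ' : algebraMap O Kv (W.localMinimalIntegralModel (placeOf 3)).Δ =
        (W.localMinimalModel (placeOf 3)).Δ :=
      integralModel_Δ_eq O (W.localMinimalModel (placeOf 3))
    rw [map_intCast, map_mul, map_pow, hΔ', hC, variableChange_Δ, ← hb, baseChange, map_Δ,
      ← cast_minimalDiscriminantInt, map_intCast]
    have h12 : ((algebraMap O Kv) b * (algebraMap O Kv) a) ^ 12 = 1 := by rw [hba, one_pow]
    linear_combination (-((W.minimalDiscriminantInt : ℤ) : Kv)) * h12

end Transport

end Summit.BirchSwinnertonDyer.BirchSwinnertonDyer.Theorems.PSTamagawaThree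

end
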